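/-
Copyright (c) 2026 the pub-hodgecm-mathlib formalisation cell (harness21).  Prover seat hodgecm-mathlib-LH4-p04 (g7), req620 Track A «(D-RAM) FOUR-FRAME» squad
(STAGE-1b; dealer∕pen LH4-plan (g13) WORD #81 ∕ heir LEAD (R-33): β₂ payer, brick (S2-a) «label face at a type-(2) cone cell»; SIG `SIG-S2a-glueValueSet.v1` ca86967b), 2026-09-04.
-/
import Literature.NumberTheory.Automorphic.UnitaryLatticeTreeBlockGlueLevel   -- ★ (E1) (LH4-p07 (g8)): block-at-1 algebra, compression, `mulVec_plane_of_row_one`; brings ★ T2c `BlockGlueFixed` (`mem_map_planeMatrix_iff`, `pairing_endoShapeForm_plane`)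
import Literature.NumberTheory.Automorphic.UnitaryLatticeTreeTubeCone         -- ★ (c3-v) `pairing_add_single_endoGL_sub_one`, `endoGL_sub_one_mulVec_add_single`
import Summits.HodgeConjecture.HodgeConjecture.Theorems.F0P3cDyRamFourFrameCensusDefs  -- ★ census DEFS (B-p08): `latticeValueSetMod` (the `f_{T₊}` label currency)
import HarnessLib

/-!
# Crux `H413`, line LH4 «(D-RAM) FOUR-FRAME» — STAGE-1b, row (2), the (β₂) road, brick (S2-a, part i): «GLUE VALUE SET, PLANE LETTERS»
# the hermitian values `⟨y, (Γ − 1)y⟩_H` on a glued lattice `M = ι_W(B₂) + 𝒪x₀`, read on the plane glue data `(B₂, w₀, x₀)`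

Cell `hodgecm-mathlib` (D-0151), FLOOR 0, crux item H413 = `stmt-HodgeConjecture-24833`, route of record `HCCMUnconditional`; squad F0∕P3c∕LH4; lane
`--supports stmt-HodgeConjecture-24833 --as helper` (count-neutral; pays NO tier-0 row).  THEOREMS ONLY (no `def`, no instance, no notation, no `sorry`, default heartbeats).
DATUM-FREE lattice algebra (`K` with `Valued K ℤᵐ⁰`, any `σ : K →+* K`, block form `H = !![H₂ 0 0, 0, H₂ 0 1; 0, h, 0; H₂ 1 0, 0, H₂ 1 1]`; no self-duality, no `|2|`, no residue field).
WHY.  The type-(2) letter (β₂) (`betaT2.letter.v1` cd9aa77b; HYPOTHESIS of ★ p860076 ∕ ★ p860151) is, by the mechanism of record (SCOPE-beta2 v1 §1, dealer WORD #81), a LABELLED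
refinement of the ★ T5s cone census: the fixed type-0 vertices of the two literals ARE the cone cells of this lineage, and the piece `f_{T₊}` reads ONE more bit per vertex — the label
`LatticeLabelPlus σ ϖ d m* M (Γ − 1)` = the class of the thickened VALUE SET `{⟨y, (Γ − 1)y⟩_Φ ∣ y ∈ M}` (★ census DEFS `latticeValueSetMod`).  LH4-p07 (g8)'s ★ (E1)
`UnitaryLatticeTreeBlockGlueLevel` evaluated the LEVEL predicates of `Γ − 1` on a glued vertex in PLANE LETTERS; THIS FILE is its VALUE-SET twin, in the same glue letters
(`hpr : |x 1|·|ϖ|^b ≤ 1 on M`, `hB : ι_W(B₂) = M ∩ W`, `hx₀ : x₀ ∈ M`, `hx₀1 : |x₀ 1|·|ϖ|^b = 1`, `hprx : pr_W x₀ = ι_W w₀`):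
* §1 `mem_glued_iff_exists_plane` — `y ∈ M ⟺ y = ι_W β + a·x₀`, `β ∈ B₂`, `|a| ≤ 1` (★ `mem_iff_exists_sub_smul_mem_of_coord_le` in plane letters);
* §2 `pairing_endoGL_sub_one_glued_plane` — for `Γ = ι(γ₂, u)`: `⟨ι_W β + a·x₀, (Γ − 1)(ι_W β + a·x₀)⟩_H = ⟨β′, (γ₂ − u)β′⟩_{H₂} + (u − 1)·(⟨β′, β′⟩_{H₂} + σ(t)·h·t)`,
  `β′ = β + a·w₀`, `t = a·x₀ 1` (★ (c3-v) `pairing_add_single_endoGL_sub_one` + ★ `pairing_endoShapeForm_plane` + ★ (E1) compression) — a TRACE-form term on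
  `B₂^♯ = B₂ + 𝒪w₀` scaled by `γ₂ − u` plus a NORM-class term `(u − 1)·h·N(t)`;
* §3 `valueSet_endoGL_sub_one_glued_eq_plane` — the thickened value set `{z ∣ ∃ y ∈ M, |(ϖ^m)⁻¹(z − ⟨y, (Γ − 1)y⟩_H)| ≤ 1}` in plane letters; at `(H₂, h) = (antidiag, 1)` its
  left side IS ★ `latticeValueSetMod σ ϖ m M (Γ − 1)` (the hyperbolic literal `ι t_h` on the nose; the anisotropic one by form transport).
* §4 `latticeValueSetMod_endoGL_sub_one_glued_eq_plane` — §3 at `Φ₃ = block(Φ₂, 1)` on the nose: ★ census DEFS `latticeValueSetMod σ ϖ m M (Γ − 1)` in plane letters.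
Part (ii) — the LABEL FACE proper (dominance of the two terms by valuation on each cone cell `(b, j, x₀·𝒪_j, z)`, ★ (C1)'s line model) — follows in a second file.
HONEST LABEL.  Count-neutral lattice algebra; nothing printed is asserted; no census law is stated; (β₂) stays a HYPOTHESIS; `HC_CM` is proved only modulo the 7 printed citations
(2 remaining named inputs: hLiu418 = `stmt-HodgeConjecture-24832`, h413 = `stmt-HodgeConjecture-24833`) until rung 0 closes.
## References
* [Jacobowitz1962] R. Jacobowitz, *Hermitian forms over local fields*, Amer. J. Math. 84 (1962): §4 (dual lattices, gluing of modular components).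
* [BruhatTits1972] F. Bruhat, J. Tits, *Groupes réductifs sur un corps local I*, Publ. Math. IHÉS 41 (1972): §10 (lattice models of the rank-one building; tube layers).
* [Kottwitz1986BaseChangeUnits] R. E. Kottwitz, *Base change for unit elements of Hecke algebras*, Compositio Math. 60 (1986): §1 pp. 240–241.
* [Rogawski1990] J. D. Rogawski, *Automorphic Representations of Unitary Groups in Three Variables*, Ann. of Math. Stud. 123 (1990): §4.8 Case (a) p. 53, §4.9 Prop. 4.9.1 (b) p. 55.
-/

set_option autoImplicit false

noncomputable section
namespace Summit.HodgeConjecture.HodgeConjecture.Cruxes.H413.F0P3cDyRamBlockGlueValueSet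

open scoped Valued WithZero Matrix MatrixGroups
open Literature.NumberTheory.Automorphic Literature.NumberTheory.Automorphic.HermitianLattice Literature.NumberTheory.Automorphic.UnitaryLatticeTree
open Literature.NumberTheory.Rogawski1990

variable {K : Type*} [Field K] [Valued K ℤᵐ⁰]

/-! ## §1 Membership in a glued lattice, in plane letters -/

/-- **`M = ι_W(B₂) + 𝒪·x₀` IN PLANE LETTERS.**  For `M` whose middle coordinates are bounded by the generator's (`|x 1|·|ϖ|^b ≤ 1` on `M`, `x₀ ∈ M`, `|x₀ 1|·|ϖ|^b = 1`) and whose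
`W`-part is `ι_W(B₂)`: `y ∈ M ⟺ ∃ β ∈ B₂, ∃ a, |a| ≤ 1 ∧ y = ι_W β + a·x₀`. [cite: BruhatTits1972, §10] [cite: Jacobowitz1962, §4] -/
theorem mem_glued_iff_exists_plane {ϖ : K} (hϖ : Valued.v ϖ = WithZero.exp (-1 : ℤ))
    {M : Submodule 𝒪[K] (Fin 3 → K)} {b : ℕ} (hpr : ∀ x ∈ M, Valued.v (x 1) * Valued.v ϖ ^ b ≤ 1)
    {B₂ : Submodule 𝒪[K] (Fin 2 → K)} {x₀ : Fin 3 → K}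
    (hB : B₂.map ((Matrix.toLin' (!![1, 0; 0, 0; 0, 1] : Matrix (Fin 3) (Fin 2) K)).restrictScalars 𝒪[K]) =
      M ⊓ LinearMap.ker ((LinearMap.proj (1 : Fin 3) : (Fin 3 → K) →ₗ[K] K).restrictScalars 𝒪[K]))
    (hx₀ : x₀ ∈ M) (hx₀1 : Valued.v (x₀ 1) * Valued.v ϖ ^ b = 1) (y : Fin 3 → K) :
    y ∈ M ↔ ∃ β ∈ B₂, ∃ a : K, Valued.v a ≤ 1 ∧ y = (![β 0, 0, β 1] : Fin 3 → K) + a • x₀ := by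
  have hϖ0 : Valued.v ϖ ≠ 0 := by rw [hϖ]; exact WithZero.exp_ne_zero
  have hϖb0 : Valued.v ϖ ^ b ≠ 0 := pow_ne_zero _ hϖ0
  have hpos : 0 < Valued.v ϖ ^ b := zero_lt_iff.2 hϖb0
  have hx₀v : Valued.v (x₀ 1) = (Valued.v ϖ ^ b)⁻¹ := eq_inv_of_mul_eq_one_left hx₀1
  have hx₀10 : x₀ 1 ≠ 0 := fun h0 => by rw [h0, map_zero, zero_mul] at hx₀1; exact zero_ne_one hx₀1
  have hmax : ∀ m ∈ M, Valued.v (m 1) ≤ Valued.v (x₀ 1) := fun m hm => by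
    rw [hx₀v, ← one_mul (Valued.v ϖ ^ b)⁻¹, le_mul_inv_iff₀ hpos]
    exact hpr m hm
  constructor
  · intro hy
    obtain ⟨t, ht, htM, ht1⟩ := (mem_iff_exists_sub_smul_mem_of_coord_le 1 hx₀ hx₀10 hmax y).1 hy
    have hker : y - t • x₀ ∈ M ⊓ LinearMap.ker ((LinearMap.proj (1 : Fin 3) : (Fin 3 → K) →ₗ[K] K).restrictScalars 𝒪[K]) := by
      refine Submodule.mem_inf.2 ⟨htM, ?_⟩
      rw [LinearMap.mem_ker]
      exact ht1
    rw [← hB, mem_map_planeMatrix_iff] at hker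
    refine ⟨![(y - t • x₀) 0, (y - t • x₀) 2], hker.2, t, ht, ?_⟩
    have e : y - t • x₀ = (![(![(y - t • x₀) 0, (y - t • x₀) 2] : Fin 2 → K) 0, 0, (![(y - t • x₀) 0, (y - t • x₀) 2] : Fin 2 → K) 1] : Fin 3 → K) := by
      conv_lhs => rw [eq_plane_of_apply_one_eq_zero ht1]
      simp
    rw [← e, sub_add_cancel]
  · rintro ⟨β, hβ, a, ha, rfl⟩
    have hιβ : (![β 0, 0, β 1] : Fin 3 → K) ∈ M := by
      have h1 : (![β 0, 0, β 1] : Fin 3 → K) ∈ B₂.map ((Matrix.toLin' (!![1, 0; 0, 0; 0, 1] : Matrix (Fin 3) (Fin 2) K)).restrictScalars 𝒪[K]) := by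
        rw [mem_map_planeMatrix_iff]
        refine ⟨rfl, ?_⟩
        have e : (![(![β 0, 0, β 1] : Fin 3 → K) 0, (![β 0, 0, β 1] : Fin 3 → K) 2] : Fin 2 → K) = β := by
          ext i; fin_cases i <;> rfl
        rw [e]; exact hβ
      rw [hB] at h1
      exact h1.1
    exact M.add_mem hιβ (smul_mem_of_v_le M ha hx₀)

/-! ## §2 The value of a glued vector against `Γ − 1`, in plane letters -/

omit [Valued K ℤᵐ⁰] in
/-- **THE VALUE OF A GLUED VECTOR AGAINST `Γ − 1`, IN PLANE LETTERS.**  For the block form `H`, the block element `Γ = ι(γ₂, u)`, a generator `x₀` with `pr_W x₀ = ι_W w₀`, and any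
`β : K²`, `a : K`:  `⟨ι_W β + a·x₀, (Γ − 1)(ι_W β + a·x₀)⟩_H = ⟨β′, (γ₂ − u)β′⟩_{H₂} + (u − 1)·(⟨β′, β′⟩_{H₂} + σ(t)·h·t)` with `β′ = β + a·w₀`, `t = a·x₀ 1` — a trace-form value
on the plane scaled by `γ₂ − u` plus a norm-class term. [cite: Jacobowitz1962, §4] [cite: Rogawski1990, §4.8 Case (a) p. 53] [cite: Kottwitz1986BaseChangeUnits, §1 pp. 240–241] -/
theorem pairing_endoGL_sub_one_glued_plane (σ : K →+* K) (H₂ : Matrix (Fin 2) (Fin 2) K) (h : K)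
    {w₀ : Fin 2 → K} {x₀ : Fin 3 → K} (hprx : x₀ - Pi.single 1 (x₀ 1) = ![w₀ 0, 0, w₀ 1])
    (γ₂ : GL (Fin 2) K) (u : GL (Fin 1) K) (β : Fin 2 → K) (a : K) :
    pairing σ (!![H₂ 0 0, 0, H₂ 0 1; 0, h, 0; H₂ 1 0, 0, H₂ 1 1] : Matrix (Fin 3) (Fin 3) K) ((![β 0, 0, β 1] : Fin 3 → K) + a • x₀) ((((endoGL (γ₂, u) : GL (Fin 3) K) : Matrix (Fin 3) (Fin 3) K) - 1) *ᵥ ((![β 0, 0, β 1] : Fin 3 → K) + a • x₀)) =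
      pairing σ H₂ (β + a • w₀) ((((γ₂ : Matrix (Fin 2) (Fin 2) K) - (u : Matrix (Fin 1) (Fin 1) K) 0 0 • (1 : Matrix (Fin 2) (Fin 2) K))) *ᵥ (β + a • w₀)) +
        ((u : Matrix (Fin 1) (Fin 1) K) 0 0 - 1) * (pairing σ H₂ (β + a • w₀) (β + a • w₀) + σ (a * x₀ 1) * h * (a * x₀ 1)) := by
  -- the glued vector in `W ⊕ Ke₁` coordinates
  have hx0 : x₀ 0 = w₀ 0 := by have := congrFun hprx 0; simpa using this
  have hx2 : x₀ 2 = w₀ 1 := by have := congrFun hprx 2; simpa using this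
  have e : (![β 0, 0, β 1] : Fin 3 → K) + a • x₀ =
      (![(β + a • w₀) 0, 0, (β + a • w₀) 1] : Fin 3 → K) + (a * x₀ 1) • (Pi.single 1 1 : Fin 3 → K) := by
    ext k; fin_cases k <;> simp [hx0, hx2]
  have hz1 : ((![(β + a • w₀) 0, 0, (β + a • w₀) 1] : Fin 3 → K)) 1 = 0 := rfl
  -- the row-`1` shape of `Γ − u·1` and its compression `γ₂ − u·1`
  have hrow : ∀ l : Fin 3, l ≠ 1 → (((endoGL (γ₂, u) : GL (Fin 3) K) : Matrix (Fin 3) (Fin 3) K) - (u : Matrix (Fin 1) (Fin 1) K) 0 0 • (1 : Matrix (Fin 3) (Fin 3) K)) 1 l = 0 :=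
    block_sub_row_one (endoGL_row_one γ₂ u) (block_smul_row_one one_row_one _)
  have hcomp : (!![(((endoGL (γ₂, u) : GL (Fin 3) K) : Matrix (Fin 3) (Fin 3) K) - (u : Matrix (Fin 1) (Fin 1) K) 0 0 • (1 : Matrix (Fin 3) (Fin 3) K)) 0 0, (((endoGL (γ₂, u) : GL (Fin 3) K) : Matrix (Fin 3) (Fin 3) K) - (u : Matrix (Fin 1) (Fin 1) K) 0 0 • (1 : Matrix (Fin 3) (Fin 3) K)) 0 2;
        (((endoGL (γ₂, u) : GL (Fin 3) K) : Matrix (Fin 3) (Fin 3) K) - (u : Matrix (Fin 1) (Fin 1) K) 0 0 • (1 : Matrix (Fin 3) (Fin 3) K)) 2 0, (((endoGL (γ₂, u) : GL (Fin 3) K) : Matrix (Fin 3) (Fin 3) K) - (u : Matrix (Fin 1) (Fin 1) K) 0 0 • (1 : Matrix (Fin 3) (Fin 3) K)) 2 2] : Matrix (Fin 2) (Fin 2) K) =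
      (γ₂ : Matrix (Fin 2) (Fin 2) K) - (u : Matrix (Fin 1) (Fin 1) K) 0 0 • (1 : Matrix (Fin 2) (Fin 2) K) := by
    rw [compress_sub, compress_smul, compress_one, compress_endoGL]
  rw [e, pairing_add_single_endoGL_sub_one σ H₂ h hz1 (a * x₀ 1) γ₂ u, mulVec_plane_of_row_one hrow, hcomp,
    pairing_endoShapeForm_plane, pairing_endoShapeForm_plane]

/-! ## §3 The thickened value set of `Γ − 1` on a glued lattice, in plane letters -/

/-- **«GLUE VALUE SET, PLANE LETTERS».**  For `M` with bounded middle coordinates, `W`-part `ι_W(B₂)`, generator `x₀` (`pr_W x₀ = ι_W w₀`), and `Γ = ι(γ₂, u)`, the value set of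
`y ↦ ⟨y, (Γ − 1)y⟩_H` on `M`, thickened by `ϖ^m`, is `{z ∣ ∃ β ∈ B₂, ∃ a, |a| ≤ 1 ∧ |(ϖ^m)⁻¹(z − (⟨β′, (γ₂ − u)β′⟩_{H₂} + (u − 1)(⟨β′, β′⟩_{H₂} + σ(t)·h·t)))| ≤ 1}`
(`β′ = β + a·w₀`, `t = a·x₀ 1`).  At `(H₂, h) = (antidiag(1,1), 1)` the left side is ★ census DEFS `latticeValueSetMod σ ϖ m M (Γ − 1)` — the label currency of `f_{T₊}`.
[cite: Jacobowitz1962, §4] [cite: Rogawski1990, §4.9 Prop. 4.9.1 (b) p. 55] [cite: Kottwitz1986BaseChangeUnits, §1 pp. 240–241] -/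
theorem valueSet_endoGL_sub_one_glued_eq_plane (σ : K →+* K) {ϖ : K} (hϖ : Valued.v ϖ = WithZero.exp (-1 : ℤ)) (H₂ : Matrix (Fin 2) (Fin 2) K) (h : K)
    {M : Submodule 𝒪[K] (Fin 3 → K)} {b : ℕ} (hpr : ∀ x ∈ M, Valued.v (x 1) * Valued.v ϖ ^ b ≤ 1)
    {B₂ : Submodule 𝒪[K] (Fin 2 → K)} {w₀ : Fin 2 → K} {x₀ : Fin 3 → K}
    (hB : B₂.map ((Matrix.toLin' (!![1, 0; 0, 0; 0, 1] : Matrix (Fin 3) (Fin 2) K)).restrictScalars 𝒪[K]) =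
      M ⊓ LinearMap.ker ((LinearMap.proj (1 : Fin 3) : (Fin 3 → K) →ₗ[K] K).restrictScalars 𝒪[K]))
    (hx₀ : x₀ ∈ M) (hx₀1 : Valued.v (x₀ 1) * Valued.v ϖ ^ b = 1) (hprx : x₀ - Pi.single 1 (x₀ 1) = ![w₀ 0, 0, w₀ 1])
    (γ₂ : GL (Fin 2) K) (u : GL (Fin 1) K) (m : ℕ) :
    {z : K | ∃ y ∈ M, Valued.v ((ϖ ^ m)⁻¹ * (z - pairing σ (!![H₂ 0 0, 0, H₂ 0 1; 0, h, 0; H₂ 1 0, 0, H₂ 1 1] : Matrix (Fin 3) (Fin 3) K) y ((((endoGL (γ₂, u) : GL (Fin 3) K) : Matrix (Fin 3) (Fin 3) K) - 1) *ᵥ y))) ≤ 1} =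
      {z : K | ∃ β ∈ B₂, ∃ a : K, Valued.v a ≤ 1 ∧
        Valued.v ((ϖ ^ m)⁻¹ * (z - (pairing σ H₂ (β + a • w₀) ((((γ₂ : Matrix (Fin 2) (Fin 2) K) - (u : Matrix (Fin 1) (Fin 1) K) 0 0 • (1 : Matrix (Fin 2) (Fin 2) K))) *ᵥ (β + a • w₀)) +
          ((u : Matrix (Fin 1) (Fin 1) K) 0 0 - 1) * (pairing σ H₂ (β + a • w₀) (β + a • w₀) + σ (a * x₀ 1) * h * (a * x₀ 1))))) ≤ 1} := by
  ext z
  simp only [Set.mem_setOf_eq]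
  constructor
  · rintro ⟨y, hy, hv⟩
    obtain ⟨β, hβ, a, ha, rfl⟩ := (mem_glued_iff_exists_plane hϖ hpr hB hx₀ hx₀1 y).1 hy
    refine ⟨β, hβ, a, ha, ?_⟩
    rwa [pairing_endoGL_sub_one_glued_plane σ H₂ h hprx γ₂ u β a] at hv
  · rintro ⟨β, hβ, a, ha, hv⟩
    refine ⟨(![β 0, 0, β 1] : Fin 3 → K) + a • x₀, (mem_glued_iff_exists_plane hϖ hpr hB hx₀ hx₀1 _).2 ⟨β, hβ, a, ha, rfl⟩, ?_⟩
    rwa [pairing_endoGL_sub_one_glued_plane σ H₂ h hprx γ₂ u β a]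

/-! ## §4 At the antidiagonal form: the census letter `latticeValueSetMod` of `Γ − 1` on a glued lattice -/

/-- **THE `f_{T₊}` LABEL CURRENCY ON A GLUED VERTEX OF THE HYPERBOLIC LITERAL.**  `Φ₃ = (StdForm.antidiagonal 3).over K` IS the block form of `(Φ₂, 1) := ((StdForm.antidiagonal 2).over K, 1)`
(by `ext`), so §3 reads ★ census DEFS `latticeValueSetMod σ ϖ m M (Γ − 1)` — the set whose class is the label `LatticeLabelPlus` of the piece `f_{T₊}` — in plane letters, for every
glued vertex `M` of `Γ = ι(γ₂, u)` (the literal `ι_w t_h = endoGL (ι_w γ_H.1, ι_w γ_H.2)` of ★ p859549 has this shape on the nose). [cite: Rogawski1990, §4.9 Prop. 4.9.1 (b) p. 55] [cite: Jacobowitz1962, §4] -/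
theorem latticeValueSetMod_endoGL_sub_one_glued_eq_plane (σ : K →+* K) {ϖ : K} (hϖ : Valued.v ϖ = WithZero.exp (-1 : ℤ))
    {M : Submodule 𝒪[K] (Fin 3 → K)} {b : ℕ} (hpr : ∀ x ∈ M, Valued.v (x 1) * Valued.v ϖ ^ b ≤ 1)
    {B₂ : Submodule 𝒪[K] (Fin 2 → K)} {w₀ : Fin 2 → K} {x₀ : Fin 3 → K}
    (hB : B₂.map ((Matrix.toLin' (!![1, 0; 0, 0; 0, 1] : Matrix (Fin 3) (Fin 2) K)).restrictScalars 𝒪[K]) =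
      M ⊓ LinearMap.ker ((LinearMap.proj (1 : Fin 3) : (Fin 3 → K) →ₗ[K] K).restrictScalars 𝒪[K]))
    (hx₀ : x₀ ∈ M) (hx₀1 : Valued.v (x₀ 1) * Valued.v ϖ ^ b = 1) (hprx : x₀ - Pi.single 1 (x₀ 1) = ![w₀ 0, 0, w₀ 1])
    (γ₂ : GL (Fin 2) K) (u : GL (Fin 1) K) (m : ℕ) :
    Summit.HodgeConjecture.HodgeConjecture.Cruxes.H413.F0P3cDyRamFourFrameCensusDefs.latticeValueSetMod σ ϖ m M (((endoGL (γ₂, u) : GL (Fin 3) K) : Matrix (Fin 3) (Fin 3) K) - 1) =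
      {z : K | ∃ β ∈ B₂, ∃ a : K, Valued.v a ≤ 1 ∧
        Valued.v ((ϖ ^ m)⁻¹ * (z - (pairing σ ((StdForm.antidiagonal 2).over K) (β + a • w₀) ((((γ₂ : Matrix (Fin 2) (Fin 2) K) - (u : Matrix (Fin 1) (Fin 1) K) 0 0 • (1 : Matrix (Fin 2) (Fin 2) K))) *ᵥ (β + a • w₀)) +
          ((u : Matrix (Fin 1) (Fin 1) K) 0 0 - 1) * (pairing σ ((StdForm.antidiagonal 2).over K) (β + a • w₀) (β + a • w₀) + σ (a * x₀ 1) * (1 : K) * (a * x₀ 1))))) ≤ 1} := by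
  have hH : (StdForm.antidiagonal 3).over K =
      !![((StdForm.antidiagonal 2).over K) 0 0, 0, ((StdForm.antidiagonal 2).over K) 0 1; 0, (1 : K), 0; ((StdForm.antidiagonal 2).over K) 1 0, 0, ((StdForm.antidiagonal 2).over K) 1 1] := by
    ext i j
    fin_cases i <;> fin_cases j <;> simp [StdForm.over, StdForm.antidiagonal_J_apply, Fin.rev]
  unfold Summit.HodgeConjecture.HodgeConjecture.Cruxes.H413.F0P3cDyRamFourFrameCensusDefs.latticeValueSetMod
  rw [hH]
  exact valueSet_endoGL_sub_one_glued_eq_plane σ hϖ ((StdForm.antidiagonal 2).over K) 1 hpr hB hx₀ hx₀1 hprx γ₂ u m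

/-! ## §5 ED. 2 (append-only): the same value in M-LETTERS, through ★ (C1)'s line model `(M, jE, ρ, Θ; φ, lam, h_M)` of `(H₂, γ₂)` -/

omit [Valued K ℤᵐ⁰] in
/-- **THE PLANE TERM IN M-LETTERS.**  In ★ (C1)'s line model of `(H₂, γ₂)` — `φ : K² →+ M` `jE`-semilinear with `φ(γ₂ x) = lam·φ x` and the form dictionary
`jE⟨x, y⟩_{H₂} = h_M·Θ(φx)·φy + ρ(h_M·Θ(φx)·φy)` — the plane summand of §2 is a ρ-TRACE: `jE⟨β′, (γ₂ − u₀₀)β′⟩_{H₂} = T + ρ T`, `T = h_M·Θ(z)·(lam − jE u₀₀)·z`, `z = φ β′`.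
[cite: Jacobowitz1962, §4] [cite: Flicker1998UnitaryFL, p. 84 REMARK] [cite: Kottwitz1986BaseChangeUnits, §1 pp. 240–241] -/
theorem map_pairing_sub_smul_one_mulVec_eq_trace {M : Type*} [Field M] (σ : K →+* K) (H₂ : Matrix (Fin 2) (Fin 2) K) (jE : K →+* M) (ρ Θ : M →+* M)
    (φ : (Fin 2 → K) →+ M) (hφs : ∀ (c : K) (x : Fin 2 → K), φ (c • x) = jE c * φ x)
    {γ₂ : GL (Fin 2) K} {lam hM : M} (hφγ : ∀ x, φ ((γ₂ : Matrix (Fin 2) (Fin 2) K) *ᵥ x) = lam * φ x)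
    (hform : ∀ x y, jE (pairing σ H₂ x y) = hM * Θ (φ x) * φ y + ρ (hM * Θ (φ x) * φ y)) (c : K) (β : Fin 2 → K) :
    jE (pairing σ H₂ β ((((γ₂ : Matrix (Fin 2) (Fin 2) K) - c • (1 : Matrix (Fin 2) (Fin 2) K))) *ᵥ β)) =
      hM * Θ (φ β) * ((lam - jE c) * φ β) + ρ (hM * Θ (φ β) * ((lam - jE c) * φ β)) := by
  have hφy : φ ((((γ₂ : Matrix (Fin 2) (Fin 2) K) - c • (1 : Matrix (Fin 2) (Fin 2) K))) *ᵥ β) = (lam - jE c) * φ β := by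
    rw [Matrix.sub_mulVec, Matrix.smul_mulVec, Matrix.one_mulVec, map_sub, hφγ, hφs, sub_mul]
  rw [hform, hφy]

omit [Valued K ℤᵐ⁰] in
/-- **THE VALUE OF A GLUED VECTOR AGAINST `Γ − 1`, IN M-LETTERS** (§2 pushed through `jE` and the line model): with `z = φ(β + a·w₀)`, `t = a·x₀ 1`, `u₀₀ = u 0 0`,
`jE⟨ι_W β + a·x₀, (Γ − 1)(ι_W β + a·x₀)⟩_H = (T₁ + ρ T₁) + (jE u₀₀ − 1)·((T₀ + ρ T₀) + jE(σ(t)·h·t))`, `T₁ = h_M·Θ(z)·(lam − jE u₀₀)·z`, `T₀ = h_M·Θ(z)·z` — a ρ-trace of the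
hermitian line value scaled by `lam − jE u₀₀` (the cone multiplier of ★ (C1)), plus `(u₀₀ − 1)` times (ρ-trace of the norm value + the line norm `σ(t)·h·t`).  This is the currency in which
(S2-b) reads purity ∕ half-half of the label per cone cell `(b, j, x₀·𝒪_j, z)`. [cite: Jacobowitz1962, §4] [cite: Flicker1998UnitaryFL, p. 84 REMARK] [cite: Rogawski1990, §4.9 Prop. 4.9.1 (b) p. 55] -/
theorem map_pairing_endoGL_sub_one_glued_eq_trace {M : Type*} [Field M] (σ : K →+* K) (H₂ : Matrix (Fin 2) (Fin 2) K) (h : K) (jE : K →+* M) (ρ Θ : M →+* M)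
    (φ : (Fin 2 → K) →+ M) (hφs : ∀ (c : K) (x : Fin 2 → K), φ (c • x) = jE c * φ x)
    {γ₂ : GL (Fin 2) K} {lam hM : M} (hφγ : ∀ x, φ ((γ₂ : Matrix (Fin 2) (Fin 2) K) *ᵥ x) = lam * φ x)
    (hform : ∀ x y, jE (pairing σ H₂ x y) = hM * Θ (φ x) * φ y + ρ (hM * Θ (φ x) * φ y))
    {w₀ : Fin 2 → K} {x₀ : Fin 3 → K} (hprx : x₀ - Pi.single 1 (x₀ 1) = ![w₀ 0, 0, w₀ 1]) (u : GL (Fin 1) K) (β : Fin 2 → K) (a : K) :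
    jE (pairing σ (!![H₂ 0 0, 0, H₂ 0 1; 0, h, 0; H₂ 1 0, 0, H₂ 1 1] : Matrix (Fin 3) (Fin 3) K) ((![β 0, 0, β 1] : Fin 3 → K) + a • x₀) ((((endoGL (γ₂, u) : GL (Fin 3) K) : Matrix (Fin 3) (Fin 3) K) - 1) *ᵥ ((![β 0, 0, β 1] : Fin 3 → K) + a • x₀))) =
      (hM * Θ (φ (β + a • w₀)) * ((lam - jE ((u : Matrix (Fin 1) (Fin 1) K) 0 0)) * φ (β + a • w₀)) + ρ (hM * Θ (φ (β + a • w₀)) * ((lam - jE ((u : Matrix (Fin 1) (Fin 1) K) 0 0)) * φ (β + a • w₀)))) +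
        (jE ((u : Matrix (Fin 1) (Fin 1) K) 0 0) - 1) * ((hM * Θ (φ (β + a • w₀)) * φ (β + a • w₀) + ρ (hM * Θ (φ (β + a • w₀)) * φ (β + a • w₀))) + jE (σ (a * x₀ 1) * h * (a * x₀ 1))) := by
  rw [pairing_endoGL_sub_one_glued_plane σ H₂ h hprx γ₂ u β a, jE.map_add, jE.map_mul, jE.map_add, jE.map_sub, jE.map_one,
    map_pairing_sub_smul_one_mulVec_eq_trace σ H₂ jE ρ Θ φ hφs hφγ hform, hform]

end Summit.HodgeConjecture.HodgeConjecture.Cruxes.H413.F0P3cDyRamBlockGlueValueSet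

end
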